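import Mathlib
import HarnessLib
import Summits.NavierStokesRegularity.NavierStokesRegularity.Theorems.PoloidalWindowDoorLrcModEntireShearedKinematics
import Summits.NavierStokesRegularity.NavierStokesRegularity.Theorems.PoloidalWindowDoorLrcModEntireQ4SonicHotSheetJet
import Summits.NavierStokesRegularity.NavierStokesRegularity.Theorems.PoloidalWindowDoorLrcModEntireHorizontalGermAtTime
import Summits.NavierStokesRegularity.NavierStokesRegularity.Theorems.PoloidalWindowDoorLrcModEntireHorizontalPeriodAtTime
import Summits.NavierStokesRegularity.NavierStokesRegularity.Theorems.PoloidalWindowDoorPoloidalWindowRigidityVelocityGradientLaw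

/-!
# Route `PoloidalWindowDoor`, item `LrcModEntire` (stmt-NavierStokesRegularity-20428), cell (Q4-sonic, straight branch), case I —
# END OF THE s-FREE BRANCH, first half: the sheared coordinates cover the slab, so `g∘Φ ≡ 0` on the tube gives `∂_eU₂ ≡ 0` on the slab

Cell ns-regularity-ideate, LEAD-lineage seat ns-poloidal-K2-p3 g17 (`--supports stmt-NavierStokesRegularity-20428`).  T2B-g17 v9 §9 «END s-free».

`…SheetSystemMixed.eq_zero_of_mixedSystem_template` concludes `g (y, m) = 0` for every `y ∈ O`, `m ∈ ℝ`, where (port-2 `…ShearedKinematics`) `g = gST W e ∘ Φ`,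
`Φ((t,s,z),m) = (t, s·e + (m + d(t,z))·Je + z·e₂)` (`…ShearedCoordinates.shearMap`).  Since `(e, Je, e₂)` is an orthonormal frame, `Φ(t,·,z,·)` is ONTO the
horizontal plane at height `z` (`shearMap_frame`), so:
* ★ `horizDeriv_two_eq_zero_of_tube` — if `O ⊇ T′ × ℝ × (−δ₁, δ₁)` and `gST W e ∘ Φ = 0` on the tube over `O`, then `∂_e W₂(t, x) = 0` for every `t ∈ T′`, `|x₂| < δ₁`
  (with `W = uncurry U`: `fderiv ℝ (U t) x e 2 = 0` on the slab — the input of ns-poloidal-K2-p2's `…HorizontalGermAtTime`, which ends the branch);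
* ★★ `false_of_gST_eq_zero_on_tube` — both halves in binder currency: class + poloidal + `hslabU` + hot value `v₂(−1,0) ≠ 0` + `|t₀+1| < ρ` + the tube statement
  at time `t₀` ⇒ `False` (`…HorizontalGermAtTime.false_of_local_horizontalDeriv_two_eq_zero_at`);
* `eq_zero_of_tube` (scalar surjectivity) and ★★ `false_of_difference_eq_zero_on_tube` — END OF THE PERIODIC BRANCH in binder currency: the pulled-back
  difference `(U₂(t,x+τ) − U₂(t,x))∘Φ` vanishes on the tube at time `t₀` (conclusion of the template for the difference system), `τ ≠ 0` horizontal ⇒ `False`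
  (`…HorizontalPeriodAtTime.false_of_local_horizontalPeriod_slab_at`, ns-poloidal-K2-p2 g17).

WHAT THIS IS NOT: not a claim about Navier–Stokes regularity and not a stub of the registry; class-free glue for the residual research cell `stub_Q4sonicLineNeg`
of `Cruxes/LrcModEntire/Lines/twist_split.lean` v13 (bears_on LADDER-NS N0 via item 20428).
-/

noncomputable section

set_option linter.dupNamespace false

namespace Summit.NavierStokesRegularity.NavierStokesRegularity.Theorems.PoloidalWindowDoorLrcModEntireShearedSurjective

open Set Function Filter Topology Metric InnerProductSpace
open scoped RealInnerProductSpace InnerProductSpace ContDiff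
open Literature.Analysis Literature.Analysis.FluidPDE
open Summit.NavierStokesRegularity.NavierStokesRegularity.Theorems.PoloidalWindowDoorPoloidalWindowRigidityWindow
open Summit.NavierStokesRegularity.NavierStokesRegularity.Theorems.PoloidalWindowDoorPoloidalWindowRigidityVelocityGradientLaw
open Summit.NavierStokesRegularity.NavierStokesRegularity.Theorems.PoloidalWindowDoorLrcModEntireHorizontalGermAtTime
open Summit.NavierStokesRegularity.NavierStokesRegularity.Theorems.PoloidalWindowDoorLrcModEntireHorizontalPeriodAtTime
open Summit.NavierStokesRegularity.NavierStokesRegularity.Theorems.PoloidalWindowDoorLrcModEntireSheetFlattenTools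
open Summit.NavierStokesRegularity.NavierStokesRegularity.Theorems.PoloidalWindowDoorLrcModEntireSheetSystemUniqueness
open Summit.NavierStokesRegularity.NavierStokesRegularity.Theorems.PoloidalWindowDoorLrcModEntireShearedCoordinates
open Summit.NavierStokesRegularity.NavierStokesRegularity.Theorems.PoloidalWindowDoorLrcModEntireShearedKinematics
open Summit.NavierStokesRegularity.NavierStokesRegularity.Theorems.PoloidalWindowDoorLrcModEntireQ4SonicHotSheetJet

/-- **The shear map hits every point**: for a horizontal unit `e`, `Φ((t, ⟪x,e⟫, x₂), ⟪x,Je⟫ − d(t,x₂)) = (t, x)`. -/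
theorem shearMap_frame {e : EuclideanSpace ℝ (Fin 3)} (he2 : e 2 = 0) (hunit : e 0 ^ 2 + e 1 ^ 2 = 1) (d : ℝ × ℝ → ℝ) (t : ℝ)
    (x : EuclideanSpace ℝ (Fin 3)) :
    shearMap e d (((t, (x 0 * e 0 + x 1 * e 1), x 2) : Y3), (x 1 * e 0 - x 0 * e 1) - d (t, x 2)) = (t, x) := by
  unfold shearMap shearPt
  simp only [sub_add_cancel]
  rw [← frame_decomp he2 hunit x]

/-- ★ **END OF THE s-FREE BRANCH (first half).**  If the pulled-back horizontal derivative `gST W e ∘ Φ` vanishes on the tube over a set `O ⊇ T′ × ℝ × (−δ₁,δ₁)`,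
then `∂_eW₂(t,x) = 0` for all `t ∈ T′`, `|x₂| < δ₁` (at points where `W` is differentiable — class profiles are smooth on the open slab). -/
theorem horizDeriv_two_eq_zero_of_tube {W : ℝ × EuclideanSpace ℝ (Fin 3) → EuclideanSpace ℝ (Fin 3)} {e : EuclideanSpace ℝ (Fin 3)} (he2 : e 2 = 0)
    (hunit : e 0 ^ 2 + e 1 ^ 2 = 1) {d : ℝ × ℝ → ℝ} {O : Set Y3} {T' : Set ℝ} {δ₁ : ℝ}
    (hO : ∀ t ∈ T', ∀ s z : ℝ, |z| < δ₁ → ((t, s, z) : Y3) ∈ O)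
    (hg : ∀ y ∈ O, ∀ m : ℝ, gST W e (shearMap e d (y, m)) = 0)
    {t : ℝ} (ht : t ∈ T') {x : EuclideanSpace ℝ (Fin 3)} (hx : |x 2| < δ₁) (hW : DifferentiableAt ℝ W (t, x)) :
    fderiv ℝ (fun y => W (t, y)) x e 2 = 0 := by
  have h := hg (t, (x 0 * e 0 + x 1 * e 1), x 2) (hO t ht _ _ hx) ((x 1 * e 0 - x 0 * e 1) - d (t, x 2))
  rw [shearMap_frame he2 hunit d t x] at h
  unfold gST at h
  rw [fderiv_slice_eq hW]
  exact h

/-- **Scalar version**: if `F ∘ Φ` vanishes on the tube over `O ⊇ T′ × ℝ × (−δ₁,δ₁)`, then `F(t,x) = 0` for `t ∈ T′`, `|x₂| < δ₁` (no differentiability needed). -/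
theorem eq_zero_of_tube {F : ℝ × EuclideanSpace ℝ (Fin 3) → ℝ} {e : EuclideanSpace ℝ (Fin 3)} (he2 : e 2 = 0) (hunit : e 0 ^ 2 + e 1 ^ 2 = 1)
    {d : ℝ × ℝ → ℝ} {O : Set Y3} {T' : Set ℝ} {δ₁ : ℝ}
    (hO : ∀ t ∈ T', ∀ s z : ℝ, |z| < δ₁ → ((t, s, z) : Y3) ∈ O)
    (hF : ∀ y ∈ O, ∀ m : ℝ, F (shearMap e d (y, m)) = 0)
    {t : ℝ} (ht : t ∈ T') {x : EuclideanSpace ℝ (Fin 3)} (hx : |x 2| < δ₁) : F (t, x) = 0 := by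
  have h := hF (t, (x 0 * e 0 + x 1 * e 1), x 2) (hO t ht _ _ hx) ((x 1 * e 0 - x 0 * e 1) - d (t, x 2))
  rwa [shearMap_frame he2 hunit d t x] at h

/-! ### Second half: inside the class, `∂_eU₂(t₀,·) ≡ 0` on the slab is absurd (ns-poloidal-K2-p2 g16 `…HorizontalGermAtTime`) -/

section Class

variable {C : ℝ} {v : ℝ → EuclideanSpace ℝ (Fin 3) → EuclideanSpace ℝ (Fin 3)}
variable (hrate : HasTypeITimeDecay C v) (hcont : ContinuousOn (uncurry v) (Iio (0 : ℝ) ×ˢ univ))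
  (hmild : ∀ s t : ℝ, s < t → t < 0 → ∀ x,
    v t x = UnboundedOperators.heatExtension (v s) (t - s) x - oseenDuhamel 1 s v v t x)
  (hdiv : ∀ t < 0, VectorCalculus.IsDivFree (v t))
include hrate hcont hmild hdiv

/-- ★★ **END OF THE s-FREE BRANCH (both halves, binder currency).**  A class profile, poloidal, with the registered slab law `hslabU` and hot value `v₂(−1,0) ≠ 0`;
a time `t₀ < 0` with `|t₀ + 1| < ρ`; a horizontal unit `e`, any offset function `d`, a tangential set `O ⊇ {t₀} × ℝ × (−δ₁,δ₁)`; IF the pulled-back horizontal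
derivative `gST (uncurry v) e ∘ Φ` vanishes on the tube over `O` (the conclusion of `…SheetSystemMixed.eq_zero_of_mixedSystem_template`), THEN `False`. -/
theorem false_of_gST_eq_zero_on_tube (hpol : ∀ s < 0, ∀ y, ⟪curl (v s) y, EuclideanSpace.single 2 1⟫_ℝ = 0)
    {μ : ℝ → ℝ → ℝ} {ρ : ℝ} (hρ : 0 < ρ)
    (hslabU : ∀ t : ℝ, |t + 1| < ρ → ∀ x : EuclideanSpace ℝ (Fin 3), |x 2| < ρ → ∀ b : Fin 3, b ≠ 2 →
      fderiv ℝ (v t) x (EuclideanSpace.single 2 1) b = μ t (x 2) * fderiv ℝ (v t) x (EuclideanSpace.single b 1) 2)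
    {e : EuclideanSpace ℝ (Fin 3)} (he2 : e 2 = 0) (hunit : e 0 ^ 2 + e 1 ^ 2 = 1) {d : ℝ × ℝ → ℝ} {O : Set Y3}
    {t₀ : ℝ} (ht₀ : t₀ < 0) (ht₀ρ : |t₀ + 1| < ρ) {δ₁ : ℝ} (hδ₁ : 0 < δ₁)
    (hO : ∀ s z : ℝ, |z| < δ₁ → ((t₀, s, z) : Y3) ∈ O)
    (hg : ∀ y ∈ O, ∀ m : ℝ, gST (uncurry v) e (shearMap e d (y, m)) = 0) (hN : v (-1) 0 2 ≠ 0) : False := by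
  have hA : IsTypeIAncientMild C v := isTypeIAncientMild_of_class hrate hcont hmild hdiv
  have hs : Differentiable ℝ (v t₀) := (hA.contDiff_slice ht₀).differentiable (by simp)
  have he : e ≠ 0 := by
    intro h0
    have h00 : e 0 = 0 := by simp [h0]
    have h01 : e 1 = 0 := by simp [h0]
    rw [h00, h01] at hunit
    norm_num at hunit
  have hV : IsOpen {x : EuclideanSpace ℝ (Fin 3) | |x 2| < δ₁} :=
    isOpen_lt (continuous_abs.comp (EuclideanSpace.proj (2 : Fin 3)).continuous) continuous_const
  have hVne : ({x : EuclideanSpace ℝ (Fin 3) | |x 2| < δ₁}).Nonempty := ⟨0, by simpa using hδ₁⟩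
  refine false_of_local_horizontalDeriv_two_eq_zero_at hrate hcont hmild hdiv hpol ht₀ hρ ht₀ρ hslabU he he2 hV hVne
    (fun x hx => ?_) hN
  -- `∂_e v₂(t₀, x) = 0` from the tube statement at the preimage of `(t₀, x)`
  have hW : DifferentiableAt ℝ (uncurry v) (t₀, x) :=
    (contDiffAt_uncurry_of_class hrate hcont hmild hdiv ht₀ x 1).differentiableAt (by norm_num)
  have h := horizDeriv_two_eq_zero_of_tube (W := uncurry v) (T' := {t₀}) he2 hunit (fun t ht s z hz => by
    rw [mem_singleton_iff.1 ht]; exact hO s z hz) hg (mem_singleton t₀) hx hW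
  -- `h : fderiv ℝ (fun y => uncurry v (t₀, y)) x e 2 = 0`, i.e. `(D(v t₀)(x) e)₂ = 0`
  have hcoord : fderiv ℝ (fun y => v t₀ y 2) x e = fderiv ℝ (v t₀) x e 2 := by
    have hc := ((EuclideanSpace.proj (𝕜 := ℝ) (2 : Fin 3)).hasFDerivAt.comp x (hs x).hasFDerivAt).fderiv
    have e3 : (⇑(EuclideanSpace.proj (𝕜 := ℝ) (2 : Fin 3)) ∘ v t₀) = fun y => v t₀ y 2 := by funext y'; simp
    rw [e3] at hc
    rw [hc]; rfl
  rw [hcoord]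
  exact h

/-- ★★ **END OF THE PERIODIC BRANCH (binder currency).**  Same setting; IF the pulled-back DIFFERENCE `(U₂(t, x + τ) − U₂(t, x)) ∘ Φ` vanishes on the tube over
`O ⊇ {t₀} × ℝ × (−δ₁,δ₁)` for a non-zero horizontal `τ` (the conclusion of `…SheetSystemMixed.eq_zero_of_mixedSystem_template` applied to the difference system,
T2B-g17 §8(8b)), THEN `False` (`…HorizontalPeriodAtTime.false_of_local_horizontalPeriod_slab_at`, ns-poloidal-K2-p2 g17). -/
theorem false_of_difference_eq_zero_on_tube (hpol : ∀ s < 0, ∀ y, ⟪curl (v s) y, EuclideanSpace.single 2 1⟫_ℝ = 0)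
    {μ : ℝ → ℝ → ℝ} {ρ : ℝ} (hρ : 0 < ρ)
    (hslabU : ∀ t : ℝ, |t + 1| < ρ → ∀ x : EuclideanSpace ℝ (Fin 3), |x 2| < ρ → ∀ b : Fin 3, b ≠ 2 →
      fderiv ℝ (v t) x (EuclideanSpace.single 2 1) b = μ t (x 2) * fderiv ℝ (v t) x (EuclideanSpace.single b 1) 2)
    {e : EuclideanSpace ℝ (Fin 3)} (he2 : e 2 = 0) (hunit : e 0 ^ 2 + e 1 ^ 2 = 1) {d : ℝ × ℝ → ℝ} {O : Set Y3}
    {t₀ : ℝ} (ht₀ : t₀ < 0) (ht₀ρ : |t₀ + 1| < ρ) {δ₁ : ℝ} (hδ₁ : 0 < δ₁)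
    (hO : ∀ s z : ℝ, |z| < δ₁ → ((t₀, s, z) : Y3) ∈ O)
    {τ : EuclideanSpace ℝ (Fin 3)} (hτ2 : τ 2 = 0) (hτ : τ ≠ 0)
    (hD : ∀ y ∈ O, ∀ m : ℝ, (fun q : ℝ × EuclideanSpace ℝ (Fin 3) => v q.1 (q.2 + τ) 2 - v q.1 q.2 2) (shearMap e d (y, m)) = 0)
    (hN : v (-1) 0 2 ≠ 0) : False := by
  have hV : IsOpen {x : EuclideanSpace ℝ (Fin 3) | |x 2| < δ₁} :=
    isOpen_lt (continuous_abs.comp (EuclideanSpace.proj (2 : Fin 3)).continuous) continuous_const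
  have hVne : ({x : EuclideanSpace ℝ (Fin 3) | |x 2| < δ₁}).Nonempty := ⟨0, by simpa using hδ₁⟩
  refine false_of_local_horizontalPeriod_slab_at hrate hcont hmild hdiv hpol hN ht₀ hρ ht₀ρ hslabU hτ2 hτ hV hVne (fun x hx => ?_)
  have h := eq_zero_of_tube (F := fun q : ℝ × EuclideanSpace ℝ (Fin 3) => v q.1 (q.2 + τ) 2 - v q.1 q.2 2) (T' := {t₀}) he2 hunit
    (fun t ht s z hz => by rw [mem_singleton_iff.1 ht]; exact hO s z hz) hD (mem_singleton t₀) hx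
  exact sub_eq_zero.1 h

end Class

end Summit.NavierStokesRegularity.NavierStokesRegularity.Theorems.PoloidalWindowDoorLrcModEntireShearedSurjective

end
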